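import Summits.ABC.IUTFork.Cor312ProvenanceDH
import Literature.IUT.LogThetaLattice.ThetaPilotObjectsIdeal
import HarnessLib

/-!
# [IUTchIII] Cor. 3.12 provenance, DH side ⟷ Def. 3.8 (i)'s Θ-pilot object as IDEALS: the log-norms of the
# Θ-pilot ideals `𝔮̲^{j²}` of the initial Θ-data average to the [IUTchIV] Thm. 1.10 Step (v) multiple of `|log(q)|`

Record-only companion (abc-iut cell, seat abc-iut-w4-d015, §F row F10-c junction offered to the Cor. 3.12 crew;
TAKES NO SIDE). abc-iut-c312-8's `Cor312ProvenanceDH.lean` links the initial Θ-data `D` ([IUTchI] Def. 3.1) to the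
Dupuy–Hilado pilot datum `X` (`IsPilotDataOf D X`) and PROVES `absLogq_eq_ndeg_qPilot : |log(q)| = deĝ̲_F(P_q)`
([IUTchIV] Thm. 1.10, p. 23: "the quantity '`|log(q)| ∈ ℝ_{>0}`' … is equal to `(1/2l)·log(q)`"). The files
`ThetaPilotObjectsFrakModel.lean`, `ThetaPilotObjectsFrakSignature.lean`, `ThetaPilotObjectsIdeal.lean` (abc-iut-w4-d015, [IUTchIII] Prop. 3.7 (v) / Def. 3.8 (i) at
the model of record) identify the `Π_j (†𝓕⊛_𝔪𝔬𝔡)_j`-incarnation of the Θ-PILOT OBJECT with the family of integral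
ideals `𝔮̲^{j²} = Π_{v ∈ 𝕍^bad} 𝔭_v^{j²·ord_v(q̲_v)} ⊆ 𝒪_F` (`thetaPilotIdeal`) and PROVE `log N(𝔮̲^{j²}) = deĝ_F(P_{Θ,j})`
(`log_absNorm_thetaPilotIdeal`). This file composes the two: under `IsPilotDataOf D X`,

* `ndeg_thetaPilot_eq_sq_mul_absLogq`: `deĝ̲_F(P_{Θ,j}) = j²·|log(q)|`;
* **`log_absNorm_thetaPilotIdeal_eq`**: `(1/[F:ℚ])·log N(𝔮̲^{j²}) = j²·|log(q)|` — the normalized log-norm of the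
  `j`-th Θ-pilot IDEAL is `j²` times [IUTchIV]'s `|log(q)|`;
* **`avg_log_absNorm_thetaPilotIdeal_eq`**: `(1/l⋆) Σ_{j=1}^{l⋆} (1/[F:ℚ])·log N(𝔮̲^{j²}) =
  ((l⋆+1)(2l⋆+1)/6)·|log(q)|` — the procession-averaged normalized log-norm of the Θ-pilot ideals is the
  multiple of `|log(q)|` whose coefficient `(l⋆+1)(2l⋆+1)/6 = (l²+…)/24·…` is the one of [IUTchIV] Thm. 1.10,
  Step (v) (abc-iut-c312-3's `degLgp_thetaPilot`).
So the real number that Cor. 3.12's "`−|log(Θ)|`" is computed from BEFORE any indeterminacy — the log-volume of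
the Θ-pilot object itself — is, in the kernel, minus the averaged log-norm of honest ideals of `𝒪_F`.
[claim: Mochizuki2012, status: disputed] for the quoted conventions; [cite: DupuyHilado2025, §3.3]. Nothing here
asserts [IUTchIII] Cor. 3.12 or takes a side; typed ≠ discharged; instantiated ≠ endorsed.
-/

noncomputable section

namespace Summit.ABC.IUTFork.Cor312Prov

open Literature.IUT.HodgeTheaters Literature.IUT.LogVolume Literature.IUT.LogThetaLattice
open NumberField IsDedekindDomain Literature.NumberTheory.EllipticCurves

universe v w

variable {F : Type} {K : Type v} {Fbar : Type w} [Field F] [NumberField F] [Field K] [NumberField K]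
  [Algebra F K] [Field Fbar] [Algebra F Fbar] [Algebra K Fbar] {E : WeierstrassCurve F} [E.IsElliptic]
  {l : ℕ} {Pb : BadPlacePredicates K}
variable {D : InitialThetaData F K Fbar E l Pb} {X : PilotData F}

/-- `deĝ̲_F(P_{Θ,j}) = j²·|log(q)|` for the pilot datum of the initial Θ-data (`P_{Θ,j} = j²·P_q`, abc-iut-c312-3;
`|log(q)| = deĝ̲_F(P_q)`, abc-iut-c312-8). [cite: DupuyHilado2025, §3.3] -/
theorem ndeg_thetaPilot_eq_sq_mul_absLogq (h : IsPilotDataOf D X) (i : Fin X.lstar) :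
    FinDivisor.ndeg F (X.thetaPilot i) = (((i : ℕ) + 1 : ℝ) ^ 2) * absLogq D := by
  rw [absLogq_eq_ndeg_qPilot h, FinDivisor.ndeg_apply, FinDivisor.ndeg_apply, PilotData.deg_thetaPilot,
    mul_div_assoc]

variable (τ : ∀ v ∈ X.S, (v.adicCompletion F)ˣ)
  (hτ : ∀ v (hv : v ∈ X.S), ‖(τ v hv : v.adicCompletion F)‖ < 1 ∧
    tateJ (τ v hv : v.adicCompletion F) = (X.jE : v.adicCompletion F))
  (ρ : ∀ v ∈ X.S, (v.adicCompletion F)ˣ) (hρ : ∀ v (hv : v ∈ X.S), ρ v hv ^ (2 * X.l) = τ v hv)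

include hτ hρ in
/-- **`(1/[F:ℚ])·log N(𝔮̲^{j²}) = j²·|log(q)|`**: the normalized log-norm of the `j`-th Θ-pilot IDEAL of Def. 3.8 (i)
(`thetaPilotIdeal`, the `Π_j (†𝓕⊛_𝔪𝔬𝔡)_j`-incarnation of the Θ-pilot object read as an ideal of `𝒪_F`) is `j²`
times [IUTchIV]'s `|log(q)|` of the initial Θ-data. [claim: Mochizuki2012, status: disputed] -/
theorem log_absNorm_thetaPilotIdeal_eq (h : IsPilotDataOf D X) (i : Fin X.lstar) :
    Real.log (Ideal.absNorm (thetaPilotIdeal X ρ i)) / Module.finrank ℚ F =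
      (((i : ℕ) + 1 : ℝ) ^ 2) * absLogq D := by
  rw [log_absNorm_thetaPilotIdeal X τ hτ ρ hρ, ← FinDivisor.ndeg_apply, ndeg_thetaPilot_eq_sq_mul_absLogq h]

include hτ hρ in
/-- **Procession average**: `(1/l⋆) Σ_{j=1}^{l⋆} (1/[F:ℚ])·log N(𝔮̲^{j²}) = ((l⋆+1)(2l⋆+1)/6)·|log(q)|` — the averaged
normalized log-norm of the Θ-pilot ideals is the [IUTchIV] Thm. 1.10, Step (v) multiple of `|log(q)|`
(abc-iut-c312-3's `degLgp_thetaPilot`, abc-iut-c312-8's `absLogq_eq_ndeg_qPilot`). [claim: Mochizuki2012, status: disputed] -/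
theorem avg_log_absNorm_thetaPilotIdeal_eq (h : IsPilotDataOf D X) :
    (1 / (X.lstar : ℝ)) * ∑ i : Fin X.lstar, Real.log (Ideal.absNorm (thetaPilotIdeal X ρ i)) / Module.finrank ℚ F
      = (((X.lstar : ℝ) + 1) * (2 * X.lstar + 1) / 6) * absLogq D := by
  have hsum : ∑ i : Fin X.lstar, Real.log (Ideal.absNorm (thetaPilotIdeal X ρ i)) / Module.finrank ℚ F =
      (∑ i : Fin X.lstar, FinDivisor.deg F (X.thetaPilot i)) / Module.finrank ℚ F := by
    rw [Finset.sum_div]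
    exact Finset.sum_congr rfl fun i _ => by rw [log_absNorm_thetaPilotIdeal X τ hτ ρ hρ i]
  rw [hsum, absLogq_eq_ndeg_qPilot h, FinDivisor.ndeg_apply]
  have hdeg := PilotData.degLgp_thetaPilot (X := X)
  rw [LgpDivisor.degLgp] at hdeg
  rw [← mul_div_assoc, hdeg]
  ring

end Summit.ABC.IUTFork.Cor312Prov
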